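import Summits.Ventures.LatticeQCDFlow.Scaling.TightSectorKLogKLaw
import Summits.Ventures.LatticeQCDFlow.Scaling.TightSectorAutocorrelationFloor
import Summits.Ventures.LatticeQCDFlow.Scaling.HalfSwapStarRecipe

/-!
HONEST FRAMING: exact (Metropolis-corrected) sampling algorithms for lattice gauge theory; figures
of merit are autocorrelation/cost numbers at stated couplings and volumes; no continuum-physics
claim.

# HalfSwapTightSectorLaw — THE HALF-SWAP HUB AT A TIGHT SECTOR, FROM BOTH SIDES, IN ONE BREATH (`t = ½`, `w_0 = 1`, `m = cK`, every cold level
# listed exactly `c` times, exact hot redraws, one-sided quality `p`, tight sector of cold mass `θ` and hot mass `≤ p'θ`, pointwise constants `p', q'`):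
# `p/(14K) ≤ Gap ≤ p'/(2K)` · `2K/p' ≤ t_rel ≤ 14K/p` · `2K/p' − ½ ≤ τ_int(g⋆)`, `τ_int(g) ≤ 14K/p − ½` · `(2K/p' − 1)·log(1/(2ε)) ≤ t_mix(ε)`,
# `(2K/(p'q'))·log((K+1)(1−ε−Kθ)) ≤ t_mix(ε) ≤ ⌈(14K/p)·log(1/(2ε·π̃_min))⌉` · `K(κ_s+κ_u)/p' ≤ cost of one relaxation ≤ 7K(κ_s+κ_u)/p` (lean-2 GEN-29, ours)

Venture-side (OURS).  Cell `lqcd-flow` (pub-lqcd), unit `pub-lqcd-lean-2-g29`, 2026-08-28.  Chapter O (the floor sees the map quality), file 10: the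
recipe card, as `Scaling/HalfSwapStarRecipe` (N17) was for chapter N.  Nothing new is proved; the chapter's laws are read at the half-swap uniform star:
`Scaling/SectorOfferCeiling` (O3) for the gap, `Scaling/TightSectorAutocorrelationFloor` (O9) for `τ_int`, `Scaling/TightSectorKLogKLaw` (O8) for the
`log K`, N2/N4/N5/N17 for the ceilings.  On the two-point witness (`Scaling/TightSectorWitness`) `p' = p` and `q' ≤ 1`.

## What is proved (hypotheses: `K ≥ 1`, `c ≥ 1`, `m = cK`, every cold level listed exactly `c` times, `w_0 = 1`, `0 < p ≤ 1`, one-sided domination,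
`μ_j`-reversible sector-idle cold kernels, exact hot redraws, `A`-preserving maps, `μ_j(A) = θ ∈ (0,1)` (`j ≠ 0`), `μ_0(A) ≤ p'θ`)

* **`halfStarUniform_spectralGap_two_sided`** — `p/(14K) ≤ Gap ≤ p'/(2K)`.
* **`halfStarUniform_relaxationTime_two_sided`** — `2K/p' ≤ t_rel ≤ 14K/p`.
* **`halfStarUniform_tauInt_two_sided`** — some `g` with `Var g = 1` has `2K/p' − ½ ≤ τ_int(g)`; every `g'` has `τ_int(g') ≤ 14K/p − ½`.
* **`halfStarUniform_mixingTime_two_sided`** — `(2K/p' − 1)·log(1/(2ε)) ≤ t_mix(ε) ≤ ⌈(14K/p)·log(1/(2ε·π̃_min))⌉` (`0 < ε ≤ ½`).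
* **`halfStarUniform_mixingTime_ge_klogk`** — pointwise `p', q'`, planted start: `(2K/(p'q'))·log((K+1)(1−ε−Kθ)) ≤ t_mix(ε)` (`ε + Kθ < 1`).
* **`halfStarUniform_cost_two_sided`** — `K(κ_s+κ_u)/p' ≤ ((κ_s+κ_u)/2)·t_rel ≤ 7K(κ_s+κ_u)/p`.

Reading (no numerics implied): at half swaps and uniform listing every figure of merit of the exact map-assisted tempering hub is pinned between
`2K/p'` and `14K/p` (times its logarithm for the cold start), and on the witness `p' = p`: ORDER `K/p` SWAP TESTS AND ORDER `K/p` HOT DRAWS per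
relaxation, autocorrelation and (up to the logarithm) per cold start, necessary and sufficient.  NOT CLAIMED: the refresh budget's own `log K`
floor; item 1; anything measured.  Literature grade (cell rule): OWN COMPOSITION; nothing cited as a fact; no new bib keys.
-/

noncomputable section

open Finset Function
open Literature.Probability.MarkovChains

namespace Summit.Ventures.LatticeQCDFlow.Scaling

variable {S : Type*} [Fintype S] [DecidableEq S] {K m : ℕ} {μ : Fin (K + 1) → S → ℝ} {M : Fin (K + 1) → S → S → ℝ}
  {w : Fin (K + 1) → ℝ} {p : ℝ}

/-- Bookkeeping at uniform listing: `m ≥ 1`, `c ≤` every multiplicity, `m = c·K` in `ℝ`. -/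
theorem halfStarUniform_basic (κ : Fin m → Fin K) (hK : 1 ≤ K) {c : ℕ} (hc1 : 1 ≤ c)
    (hceq : ∀ k : Fin K, (univ.filter (fun r : Fin m => κ r = k)).card = c) (hmc : m = c * K) :
    1 ≤ m ∧ (∀ k : Fin K, c ≤ (univ.filter (fun r : Fin m => κ r = k)).card) ∧ ((m : ℝ) = c * K) := by
  refine ⟨?_, fun k => (hceq k).ge, by rw [hmc, Nat.cast_mul]⟩
  rw [hmc]; exact Nat.one_le_iff_ne_zero.mpr (Nat.mul_ne_zero (by omega) (by omega))

section HalfSwap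
variable (κ : Fin m → Fin K) (φ : Fin m → Equiv.Perm S)
variable [Nontrivial S] (hK : 1 ≤ K) {c : ℕ} (hc1 : 1 ≤ c) (hceq : ∀ k : Fin K, (univ.filter (fun r : Fin m => κ r = k)).card = c)
  (hmc : m = c * K) (hw0 : ∀ k, 0 ≤ w k) (hw01 : w 0 = 1) (hw1 : ∑ k, w k = 1) (hμ : ∀ k x, 0 < μ k x)
  (hμ1 : ∀ k, ∑ u, μ k u = 1) (hM : ∀ k, IsRowStochastic (M k)) (hMrev : ∀ k, DetailedBalance (μ k) (M k))
  (hM0 : ∀ u v, M 0 u v = μ 0 v) (hp0 : 0 < p) (hp1 : p ≤ 1) (hdom : ∀ r u, p * μ (κ r).succ (φ r u) ≤ μ 0 u)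
  {A : Finset S} (hφA : ∀ r u, φ r u ∈ A ↔ u ∈ A) {θ p' : ℝ} (hθ0 : 0 < θ) (hθ1 : θ < 1)
  (hcold : ∀ j : Fin (K + 1), j ≠ 0 → ∑ u ∈ A, μ j u = θ) (hhot : ∑ u ∈ A, μ 0 u ≤ p' * θ)
  (hidle : ∀ k : Fin (K + 1), k ≠ 0 → w k * edgeMeasure (μ k) (M k) A Aᶜ = 0)
include hK hc1 hceq hmc hw0 hw01 hw1 hμ hμ1 hM hMrev hM0 hp0 hp1 hdom hφA hθ0 hθ1 hcold hhot hidle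

/-- **`p/(14K) ≤ Gap ≤ p'/(2K)`.** [ours] -/
theorem halfStarUniform_spectralGap_two_sided :
    p / (14 * K) ≤ spectralGap (tensorFun μ) (fun y z : Fin (K + 1) → S =>
        (1 / 2 : ℝ) * ptGraphSwap μ (fun r : Fin m => (((0 : Fin (K + 1)), (κ r).succ) : Fin (K + 1) × Fin (K + 1))) φ y z
          + (1 - 1 / 2) * prodKernel w M y z)
    ∧ spectralGap (tensorFun μ) (fun y z : Fin (K + 1) → S =>
        (1 / 2 : ℝ) * ptGraphSwap μ (fun r : Fin m => (((0 : Fin (K + 1)), (κ r).succ) : Fin (K + 1) × Fin (K + 1))) φ y z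
          + (1 - 1 / 2) * prodKernel w M y z) ≤ p' / (2 * K) := by
  obtain ⟨hm, hc, hmR⟩ := halfStarUniform_basic κ hK hc1 hceq hmc
  have hKpos : (0 : ℝ) < K := Nat.cast_pos.mpr (by omega)
  have hcpos : (0 : ℝ) < c := Nat.cast_pos.mpr (by omega)
  have hw00 : 0 < w 0 := by rw [hw01]; exact one_pos
  obtain ⟨hlo, hhi⟩ := tightSector_spectralGap_two_sided_level κ φ hK hm (by norm_num : (0 : ℝ) < 1 / 2) (by norm_num) hw0 hw00 hw1 hμ hμ1
    hM hMrev hM0 hp0 hp1 hdom hc1 hc hφA hθ0 hθ1 hcold hhot ⟨0, by omega⟩ (hidle _ (Fin.succ_ne_zero _))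
  refine ⟨?_, ?_⟩
  · refine le_trans ?_ hlo
    have h := halfStar_min_ge (w := w) hK hm hw01 hmR.le
    calc p / (14 * K) = p * (1 / (14 * K)) := by ring
      _ ≤ _ := mul_le_mul_of_nonneg_left h hp0.le
  · refine hhi.trans (le_of_eq ?_)
    rw [hceq, hmR]
    field_simp

/-- **`2K/p' ≤ t_rel ≤ 14K/p`.** [ours] -/
theorem halfStarUniform_relaxationTime_two_sided :
    2 * K / p' ≤ relaxationTime (fun y z : Fin (K + 1) → S =>
        (1 / 2 : ℝ) * ptGraphSwap μ (fun r : Fin m => (((0 : Fin (K + 1)), (κ r).succ) : Fin (K + 1) × Fin (K + 1))) φ y z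
          + (1 - 1 / 2) * prodKernel w M y z)
    ∧ relaxationTime (fun y z : Fin (K + 1) → S =>
        (1 / 2 : ℝ) * ptGraphSwap μ (fun r : Fin m => (((0 : Fin (K + 1)), (κ r).succ) : Fin (K + 1) × Fin (K + 1))) φ y z
          + (1 - 1 / 2) * prodKernel w M y z) ≤ 14 * K / p := by
  obtain ⟨hm, hc, hmR⟩ := halfStarUniform_basic κ hK hc1 hceq hmc
  have hKpos : (0 : ℝ) < K := Nat.cast_pos.mpr (by omega)
  have hw00 : 0 < w 0 := by rw [hw01]; exact one_pos
  have hpp' : p ≤ p' := tightSector_floor_le_ceiling κ φ hm hdom hφA hθ0 hcold hhot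
  have hp'0 : 0 < p' := lt_of_lt_of_le hp0 hpp'
  refine ⟨?_, halfStar_relaxationTime_le κ φ hK hm hw0 hw01 hw1 hμ hμ1 hM hMrev hM0 hp0 hp1 hdom hc1 hc hmR.le⟩
  set e : Fin m → Fin (K + 1) × Fin (K + 1) := fun r => (((0 : Fin (K + 1)), (κ r).succ) : Fin (K + 1) × Fin (K + 1)) with he_def
  set P : (Fin (K + 1) → S) → (Fin (K + 1) → S) → ℝ := fun y z => (1 / 2 : ℝ) * ptGraphSwap μ e φ y z + (1 - 1 / 2) * prodKernel w M y z
    with hPdef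
  have hγpos : 0 < absSpectralGap P :=
    lt_of_lt_of_le (by positivity) (halfStar_absSpectralGap_ge κ φ hK hm hw0 hw01 hw1 hμ hμ1 hM hMrev hM0 hp0 hp1 hdom hc1 hc hmR.le)
  have hirr := dominatedStar_isIrreducible_regimeFree κ φ (t := 1 / 2) (by norm_num) (by norm_num) hw0 hw00 hw1 hμ hM hM0 hc1 hc
  have hPst : IsRowStochastic P :=
    weightedScheme_isRowStochastic (ptGraphSwap_isRowStochastic (e := e) (φ := φ) hμ) hM hw0 hw1 (by norm_num) (by norm_num)
  have hDB : DetailedBalance (tensorFun μ) P :=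
    weightedScheme_detailedBalance (w := w) (ptGraphSwap_detailedBalance (e := e) (φ := φ) hμ) hMrev (1 / 2)
  have hγle : absSpectralGap P ≤ spectralGap (tensorFun μ) P :=
    absSpectralGap_le_spectralGap (tensorFun_pos hμ) (sum_tensorFun_eq_one μ hμ1) hPst hDB hirr
  have hceil := (halfStarUniform_spectralGap_two_sided κ φ hK hc1 hceq hmc hw0 hw01 hw1 hμ hμ1 hM hMrev hM0 hp0 hp1 hdom hφA hθ0 hθ1
    hcold hhot hidle).2
  unfold relaxationTime
  rw [div_le_div_iff₀ hp'0 hγpos]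
  calc 2 * K * absSpectralGap P ≤ 2 * K * (p' / (2 * K)) := mul_le_mul_of_nonneg_left (hγle.trans hceil) (by positivity)
    _ = 1 * p' := by field_simp

/-- **`2K/p' − ½ ≤ τ_int(g)` for some `g` with `Var g = 1`, and `τ_int(g') ≤ 14K/p − ½` for every `g'` of positive variance.** [ours] -/
theorem halfStarUniform_tauInt_two_sided :
    (∃ g : (Fin (K + 1) → S) → ℝ, lawVariance (tensorFun μ) g = 1 ∧
      2 * K / p' - 1 / 2 ≤ asympVar g (tensorFun μ) (fun y z : Fin (K + 1) → S =>
        (1 / 2 : ℝ) * ptGraphSwap μ (fun r : Fin m => (((0 : Fin (K + 1)), (κ r).succ) : Fin (K + 1) × Fin (K + 1))) φ y z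
          + (1 - 1 / 2) * prodKernel w M y z) / (2 * lawVariance (tensorFun μ) g))
    ∧ ∀ g' : (Fin (K + 1) → S) → ℝ, 0 < lawVariance (tensorFun μ) g' →
      asympVar g' (tensorFun μ) (fun y z : Fin (K + 1) → S =>
        (1 / 2 : ℝ) * ptGraphSwap μ (fun r : Fin m => (((0 : Fin (K + 1)), (κ r).succ) : Fin (K + 1) × Fin (K + 1))) φ y z
          + (1 - 1 / 2) * prodKernel w M y z) / (2 * lawVariance (tensorFun μ) g') ≤ 14 * K / p - 1 / 2 := by
  obtain ⟨hm, hc, hmR⟩ := halfStarUniform_basic κ hK hc1 hceq hmc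
  have hKpos : (0 : ℝ) < K := Nat.cast_pos.mpr (by omega)
  have hw00 : 0 < w 0 := by rw [hw01]; exact one_pos
  obtain ⟨⟨g, hg, hfloor⟩, hceil⟩ := tightSector_tauInt_two_sided κ φ hK hm (by norm_num : (0 : ℝ) < 1 / 2) (by norm_num) hw0 hw00 hw1 hμ hμ1
    hM hMrev hM0 hp0 hp1 hdom hc1 hc hφA hθ0 hθ1 hcold hhot ⟨0, by omega⟩ (hidle _ (Fin.succ_ne_zero _))
  refine ⟨⟨g, hg, le_trans (le_of_eq ?_) hfloor⟩, fun g' hg' => (hceil g' hg').trans ?_⟩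
  · rw [hceq, hmR]; field_simp
  · have h := halfStar_inv_le (w := w) hK hm hw01 hp0 hmR.le
    linarith

/-- **`(2K/p' − 1)·log(1/(2ε)) ≤ t_mix(ε) ≤ ⌈(14K/p)·log(1/(2ε·π̃_min))⌉`** (`0 < ε ≤ ½`, `π̃ ≥ π̃_min > 0`). [ours] -/
theorem halfStarUniform_mixingTime_two_sided {πmin : ℝ} (hmin0 : 0 < πmin) (hmin : ∀ x, πmin ≤ tensorFun μ x) {ε : ℝ} (hε : 0 < ε)
    (hε2 : ε ≤ 1 / 2) :
    (2 * K / p' - 1) * Real.log (1 / (2 * ε))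
      ≤ (mixingTime (fun y z : Fin (K + 1) → S =>
          (1 / 2 : ℝ) * ptGraphSwap μ (fun r : Fin m => (((0 : Fin (K + 1)), (κ r).succ) : Fin (K + 1) × Fin (K + 1))) φ y z
            + (1 - 1 / 2) * prodKernel w M y z) (tensorFun μ) ε : ℝ)
    ∧ mixingTime (fun y z : Fin (K + 1) → S =>
          (1 / 2 : ℝ) * ptGraphSwap μ (fun r : Fin m => (((0 : Fin (K + 1)), (κ r).succ) : Fin (K + 1) × Fin (K + 1))) φ y z
            + (1 - 1 / 2) * prodKernel w M y z) (tensorFun μ) ε ≤ ⌈14 * K / p * Real.log (1 / (2 * ε * πmin))⌉₊ := by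
  obtain ⟨hm, hc, hmR⟩ := halfStarUniform_basic κ hK hc1 hceq hmc
  have hKpos : (0 : ℝ) < K := Nat.cast_pos.mpr (by omega)
  have hw00 : 0 < w 0 := by rw [hw01]; exact one_pos
  have hpp' : p ≤ p' := tightSector_floor_le_ceiling κ φ hm hdom hφA hθ0 hcold hhot
  have hp'0 : 0 < p' := lt_of_lt_of_le hp0 hpp'
  refine ⟨?_, halfStar_mixingTime_le κ φ hK hm hw0 hw01 hw1 hμ hμ1 hM hMrev hM0 hp0 hp1 hdom hc1 hc hmR.le hmin0 hmin hε⟩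
  have hlog : 0 ≤ Real.log (1 / (2 * ε)) := Real.log_nonneg (by rw [le_div_iff₀ (by positivity)]; linarith)
  by_cases hsmall : (1 / 2 : ℝ) * ((univ.filter (fun r : Fin m => κ r = (⟨0, by omega⟩ : Fin K))).card : ℝ) * p' < m
  · have h := tightSector_mixingTime_ge_level κ φ hK hm (by norm_num : (0 : ℝ) < 1 / 2) (by norm_num) hw0 hw00 hw1 hμ hμ1 hM hMrev hM0
      hp0 hp1 hdom hc1 hc hφA hθ0 hθ1 hcold hhot ⟨0, by omega⟩ (hidle _ (Fin.succ_ne_zero _)) hsmall hε hε2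
    refine le_trans (le_of_eq ?_) h
    rw [hceq, hmR]; field_simp
  · -- `2K/p' ≤ 1`: the floor's factor is `≤ 0`
    have hle : 2 * K / p' ≤ 1 := by
      rw [not_lt, hceq, hmR] at hsmall
      rw [div_le_one hp'0]
      have hcpos : (0 : ℝ) < c := Nat.cast_pos.mpr (by omega)
      nlinarith
    exact le_trans (mul_nonpos_of_nonpos_of_nonneg (by linarith) hlog) (Nat.cast_nonneg _)

omit hθ0 hθ1 hhot in
/-- **`(2K/(p'·q'))·log((K+1)(1−ε−Kθ)) ≤ t_mix(ε)` from the planted start** (pointwise tightness `p'` on `A` and light-side ratio `q'`, `ε > 0`,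
`ε + Kθ < 1`). [ours] -/
theorem halfStarUniform_mixingTime_ge_klogk {q' : ℝ} (hp'0 : 0 < p') (hq' : 0 < q')
    (htight : ∀ r, ∀ z ∈ A, μ 0 ((φ r).symm z) ≤ p' * μ (κ r).succ z) (hlight : ∀ r, ∀ u ∉ A, μ (κ r).succ (φ r u) ≤ q' * μ 0 u)
    (x : Fin (K + 1) → S) (hx : ∀ k : Fin K, x k.succ ∈ A) {ε : ℝ} (hε0 : 0 < ε) (hε : ε + K * θ < 1) :
    2 * K / (p' * q') * Real.log (((K : ℝ) + 1) * (1 - ε - K * θ))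
      ≤ (mixingTime (fun y z : Fin (K + 1) → S =>
          (1 / 2 : ℝ) * ptGraphSwap μ (fun r : Fin m => (((0 : Fin (K + 1)), (κ r).succ) : Fin (K + 1) × Fin (K + 1))) φ y z
            + (1 - 1 / 2) * prodKernel w M y z) (tensorFun μ) ε : ℝ) := by
  obtain ⟨hm, hc, hmR⟩ := halfStarUniform_basic κ hK hc1 hceq hmc
  have hKpos : (0 : ℝ) < K := Nat.cast_pos.mpr (by omega)
  have hcpos : (0 : ℝ) < c := Nat.cast_pos.mpr (by omega)
  have hw00 : 0 < w 0 := by rw [hw01]; exact one_pos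
  have h := dominatedStar_mixingTime_ge_klogk κ φ hK hm (by norm_num : (0 : ℝ) < 1 / 2) (by norm_num) hw0 hw00 hw1 hμ hμ1 hM hMrev hM0
    hp0 hp1 hdom hc1 hc (fun k => (hceq k).le) hφA hp'0 hq' htight hlight hidle (fun k => (hcold k.succ (Fin.succ_ne_zero k)).le) x hx hε0 hε
  refine le_trans (le_of_eq ?_) h
  rw [hmR]; field_simp

/-- **`K(κ_s+κ_u)/p' ≤ ((κ_s+κ_u)/2)·t_rel ≤ 7K(κ_s+κ_u)/p`** (a swap test costs `κ_s ≥ 0`, the exact hot draw `κ_u ≥ 0`). [ours] -/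
theorem halfStarUniform_cost_two_sided {κs κu : ℝ} (hκs : 0 ≤ κs) (hκu : 0 ≤ κu) :
    K * (κs + κu) / p'
        ≤ ((κs + κu) / 2) * relaxationTime (fun y z : Fin (K + 1) → S =>
            (1 / 2 : ℝ) * ptGraphSwap μ (fun r : Fin m => (((0 : Fin (K + 1)), (κ r).succ) : Fin (K + 1) × Fin (K + 1))) φ y z
              + (1 - 1 / 2) * prodKernel w M y z)
    ∧ ((κs + κu) / 2) * relaxationTime (fun y z : Fin (K + 1) → S =>
            (1 / 2 : ℝ) * ptGraphSwap μ (fun r : Fin m => (((0 : Fin (K + 1)), (κ r).succ) : Fin (K + 1) × Fin (K + 1))) φ y z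
              + (1 - 1 / 2) * prodKernel w M y z) ≤ 7 * K * (κs + κu) / p := by
  obtain ⟨hm, hc, hmR⟩ := halfStarUniform_basic κ hK hc1 hceq hmc
  have hpp' : p ≤ p' := tightSector_floor_le_ceiling κ φ hm hdom hφA hθ0 hcold hhot
  have hp'0 : 0 < p' := lt_of_lt_of_le hp0 hpp'
  obtain ⟨hrel, _⟩ := halfStarUniform_relaxationTime_two_sided κ φ hK hc1 hceq hmc hw0 hw01 hw1 hμ hμ1 hM hMrev hM0 hp0 hp1 hdom hφA
    hθ0 hθ1 hcold hhot hidle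
  refine ⟨?_, halfStar_relaxationCost_le κ φ hK hm hw0 hw01 hw1 hμ hμ1 hM hMrev hM0 hp0 hp1 hdom hc1 hc hmR.le hκs hκu⟩
  have e : (K : ℝ) * (κs + κu) / p' = ((κs + κu) / 2) * (2 * K / p') := by field_simp
  rw [e]
  exact mul_le_mul_of_nonneg_left hrel (by positivity)

end HalfSwap

end Summit.Ventures.LatticeQCDFlow.Scaling

end
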